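import Summits.BirchSwinnertonDyer.Rank1Residual.Additive.KatoDescentRankOnePR
import HarnessLib

/-!
# The rank-ONE Kato descent at an additive potentially good prime, SPLIT (T-w-r1′): a PRINTED count
# reading through the Perrin-Riou ratio `ℒ`, and the stand-alone conjecture node PR^× =
# `PerrinRiouUpToUnitAt` (cell `bsd-potss`, seat `kmc`, generation 2; part 5 of the descent files)

HONEST FRAMING (cell `bsd-potss`, `run/shared/lean/pub/bsd-potss/`; memo of record
`pub/bsd-potss/bsd-potss-kmc/KMC-DESCENT-MEMO.md` v2 §4–§4b): NOTHING is asserted. Part 3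
(`Additive/KatoDescentRankOnePR.lean`) bundled the rank-`1` Poitou–Tate count (a derivation from
printed theorems, referee PASS at paper level, `pub/bsd-potss/ref/MEMO-GRADES-g2-v1.md`) WITH the
conjectural Perrin-Riou input (T-O6-A1′) in ONE schema `RankOnePRCountReading`. The cell planner
(TARGET.md v2 §0.3/§1.3, target T-w-r1′) found the printed antecedents — Burns–Kurihara–Sano,
*On derivatives of Kato's Euler system for elliptic curves*, arXiv:1910.07404 (J. Math. Soc. Japan):
Conj. 2.8 (ii) = Perrin-Riou's conjecture [p. 10], Thm. 1.4 [p. 4], Conj. 1.5 / Remark 1.7 [p. 5],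
Hyp. 2.2 [p. 9], Thm. 7.3 / Thm. 7.6 / Remark 7.7 [p. 29], Thm. 7.8 (d) [p. 30] — and asked for the
SPLIT carried out here:

* the conjecture becomes a NAMED NODE `PerrinRiouUpToUnitAt PRRatio W p` (PR^×: Perrin-Riou's
  formula for the position of Kato's zeta element in `E(ℚ) ⊗ ℚ_p` UP TO A `p`-ADIC UNIT, in the
  valuation currency the BSD_p consumers need), over ONE interface predicate `PRRatio` (below);
* the count becomes the PRINTED-shape reading `RankOneCountReading IsOf PRRatio`, stated through the
  **Perrin-Riou ratio** `ℒ ∈ ℚ_p` of the zeta element so that the local index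
  `e = [E(ℚ_p) ⊗ ℤ_p/tors : ℤ_p P]`, the local torsion `p^t = #E(ℚ_p)[p^∞]`, the component index
  `p^a` and `c_p` ALL CANCEL from the statement: for a realised datum with
  `[H¹(ℤ[1/p],T) : z] = p^m · #H²(ℤ[1/p],T)` one has **`v_p(ℒ) = m + ord_p #Ш[p^∞] + ord_p Tam(E)`** —
  at `m = 0` (i.e. under KMC⁰) this is VERBATIM Burns–Kurihara–Sano Thm. 7.3 / Thm. 7.8 (d) at
  `r = 1` in Kato's normalisation (`κ_∞ = z`, `R_ω^{Boc} = log_ω(x)·x` by their Remark 1.7 (i));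
* the old schema is RECOVERED: `rankOnePRCountReading_of_count_of_perrinRiou` (count ∧ PR^× on the
  rows ⇒ `RankOnePRCountReading IsOf`), so every theorem of part 4
  (`Additive/KMCTrivialDescentRankOne.lean`) keeps applying; the sharper per-pair consumers
  `KMC⁰(W,p) → PerrinRiouUpToUnitAt W p → BSD_p(W)` and the Burns–Kurihara–Sano triangle "any two of
  {KMC⁰, BSD_p, PR^×} give the third" are part 6 (`Additive/KMCPerrinRiouDescentRankOne.lean`).

## The interface predicate `PRRatio W p ℒ` (section variable; D-O6-2-style definition request)

MEANING (fixed here, used identically by both readings): `p` odd, `W/ℚ` globally minimal with Néron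
differential `ω`, `T = T_pW`, (12.5.2); `z ∈ H¹(ℤ[1/p], T)` the bottom layer of Kato's zeta element
`(z_γ^{(p)})⁰` on the `Δ`-trivial component, `γ ∈ V_{ℤ_p}(f)` with `γ⁺` a `ℤ_p`-basis of `T(−1)⁺`
(Kato Thm. 12.5 (1), (4), Prop. 14.16 conventions; integral by 12.5 (4) under `p ≠ 2` + (12.5.2);
well defined up to `ℤ_p^×`) — the SAME `z` whose class `ι(z̄)` the datum `D` of `IsOf W p D` carries
(part 1, `Additive/KatoDescentDatum.lean`); `x ∈ E(ℚ)` a generator modulo torsion (rank one).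
Then `loc_p z ∈ H¹_f(ℚ_p, T) = E(ℚ_p) ⊗̂ ℤ_p` (rank one: `H¹(G_S,T) = ℤ_p·κ(x)` is all Bloch–Kato-`f`),
and **`ℒ := log_ω(loc_p z) / log_ω(x)² ∈ ℚ_p`** — Burns–Kurihara–Sano's display of Thm. 1.4
[p. 4: `log_ω(z_ℚ) = (L′_S(E,1)/(Ω⁺·⟨x,x⟩_∞))·log_ω(x)²`] solved for the `L`-value; independent of
the sign of `x` and of `ω`; changing `γ` by a unit changes `ℒ` by a unit. `PRRatio W p ℒ` := "`ℒ` is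
this ratio for an admissible `γ`". NORMALISATION NOTE: Kato's `z_γ` is `L_{(p)}`-depleted only
(Thm. 12.5 (1)), and `L_p(E,s) = 1` at an additive `p`; Burns–Kurihara–Sano's `z_ℚ(ξ, S)` is
`L_S`-depleted, so in THEIR normalisation both readings below acquire the same summand
`v_p(∏_{ℓ ∈ S∖∞} L_ℓ)` (`L_ℓ` = Euler polynomial at `ℓ⁻¹`, their (2.?) with `L_S^* = (∏ L_ℓ)·L^*`
[p. 11, p. 18]) — it cancels in every consumer; nothing here depends on the choice.

## Contents

§1 `HasPRRatio PRRatio` — READING 4 (realizability of `ℒ` in analytic rank one: Kato 12.5 (4) puts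
`z` in `H¹(ℤ[1/p],T) ⊂ H¹(G_S,T) = ℤ_p κ(x)`; `log_ω(x) ≠ 0` for non-torsion `x`).
§2 `RankOneCountReading IsOf PRRatio` — READING 1″ (the count; printed shape, derivation R1-a…R1-f of
the memo = Kato (14.9.3) + Poitou–Tate for the Selmer structures Kummer ⊂ unramified-at-`ℓ ≠ p`
(Rubin, *Euler Systems*, Thm. 1.7.3) with the EXACT-ANNIHILATOR step at `ℓ ≠ p` (Coates, LNM 1716,
Lemma 3.6 + proof, Lemma 3.8: `H¹_ur(ℚ_ℓ,T) = κ(E₀(ℚ_ℓ)[p^∞])` is the exact orthogonal complement of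
`H¹_ur(ℚ_ℓ,E[p^∞])`, orders `#Ẽ_ns(𝔽_ℓ)(p)` and `c_ℓ^{(p)}`, because `E₀(ℚ_ℓ^{ur})` is
`p`-divisible) + Greenberg LNM 1716 §3 + the additive local index `log_ω(E(ℚ_p) ⊗ ℤ_p) =
p^{t − v_p(c_p)} ℤ_p` (C.-H. Kim AJM 2026 §3.2.3; tree `O6.integralLogAdditive_holds`); its `m = 0`
case is Burns–Kurihara–Sano Thm. 7.3 / 7.8 (d)).
§3 `PerrinRiouUpToUnitAt PRRatio W p` — THE CONJECTURE NODE PR^× (`@[conjecture]`).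
§4 Bookkeeping `L′/(Ω·Reg) ↔ #Ш_an` and the RECOVERY of part 3's schema.

WHAT THIS IS NOT: not a proof of Perrin-Riou's conjecture at any prime (in print it is a theorem
only for `p ∤ 2N`: Burungale–Skinner–Tian–Wan arXiv:2409.01350 Thm. 6.4 / Cor. 6.5, Büyükboduk,
Büyükboduk–Pollack–Sasaki, Bertolini–Darmon–Venerucci; Venerucci at split multiplicative `p`;
NOTHING at `p ∣ N` additive); not a construction of `z_Kato`, `log_ω` or `ℒ` in the tree (interface;
definition request D-O6-2 stands, now with the sub-request "`PRRatio` realised"); nothing at `p = 2`,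
at a potentially multiplicative `p`, without (12.5.2), or in analytic rank `≠ 1`.

References: Burns–Kurihara–Sano, arXiv:1910.07404 [BurnsKuriharaSano2019] Thm. 1.4 (p. 4),
Conj. 1.5 / Rem. 1.7 (p. 5), Rem. 2.1 (p. 8), Hyp. 2.2 / Rem. 2.3 / Rem. 2.5 (p. 9), Conj. 2.8
(p. 10), Conj. 7.1 / Rem. 7.2 / Thm. 7.3 / Thm. 7.6 / Rem. 7.7 (p. 29), Thm. 7.8 (p. 30);
B. Perrin-Riou, Ann. Inst. Fourier 43 (1993) §3.3 [PerrinRiou1993AIF]; K. Kato, Astérisque 295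
(2004) Thm. 12.5, (12.5.2), Conj. 12.10, Thm. 14.5 (3), (14.9.3), §14.14 [Kato2004Asterisque];
K. Rubin, *Euler Systems* Thm. 1.7.3 [Rubin2000]; J. Coates, LNM 1716 (1999) Lemmas 3.6, 3.8
[CoatesLNM1716]; R. Greenberg, LNM 1716 §3 [GreenbergLNM1716]; C.-H. Kim, AJM 148 (2026) §3.2.3
[Kim2022StructureSelmer]; Burungale–Skinner–Tian–Wan arXiv:2409.01350 §6 [BurungaleSkinnerTianWan2024];
R. L. Miller, LMS JCM 14 (2011) Def. 1.1 [Miller2011LMS].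
-/

set_option autoImplicit false

noncomputable section

open scoped Classical

open WeierstrassCurve Literature.NumberTheory.EllipticCurves
  Literature.NumberTheory.EllipticCurves.Rank1Residual
  Literature.NumberTheory.EllipticCurves.Rank1Residual.Typed
  Literature.NumberTheory.EllipticCurves.IwasawaAlgebra

namespace Summit.BirchSwinnertonDyer.Rank1Residual.Additive

section Readings

variable (IsOf : ∀ (W : WeierstrassCurve ℚ) [W.IsElliptic] [W.IsGloballyMinimal] (p : ℕ) [Fact p.Prime],
  KatoDescentDatum p → Prop)
variable (PRRatio : ∀ (W : WeierstrassCurve ℚ) [W.IsElliptic] [W.IsGloballyMinimal] (p : ℕ)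
  [Fact p.Prime], ℚ_[p] → Prop)

/-! ## §1 Reading 4 — the Perrin-Riou ratio exists in analytic rank one -/

/-- **READING 4 — the Perrin-Riou ratio `ℒ` of Kato's zeta element is DEFINED in analytic rank one**
(module docstring for the meaning of `PRRatio W p ℒ`). For `W/ℚ` globally minimal with `r_an = 1`,
`p ≠ 2` additive and potentially good, (12.5.2): `z ∈ H¹(ℤ[1/p], T)` (Kato Thm. 12.5 (4)) lies in
`H¹(G_S,T) = ℤ_p·κ(x)` (rank one, `E(ℚ)[p] = 0`, `Ш[p^∞]` finite by Gross–Zagier–Kolyvagin; memo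
R1-a, referee PASS), which is Bloch–Kato-`f` at `p`, and `log_ω(x) ≠ 0` for the non-torsion generator
`x`; so `ℒ = log_ω(loc_p z)/log_ω(x)²` exists (Burns–Kurihara–Sano Hyp. 2.2 / Rem. 2.3 and the display
(h1) `H¹(ℤ_S,V) ≅ ℚ_p ⊗ E(ℚ)` [p. 9]). Hypothesis schema over the interface; nothing asserted.
[cite: Kato2004Asterisque, Thm. 12.5 (4) (p. 222)] [cite: BurnsKuriharaSano2019, Hyp. 2.2 and Remark 2.3 (p. 9), Thm. 1.4 (p. 4)] -/
def HasPRRatio : Prop :=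
  ∀ (W : WeierstrassCurve ℚ) [W.IsElliptic] [W.IsGloballyMinimal] (p : ℕ) [Fact p.Prime],
    W.analyticRank = 1 → p ≠ 2 → Addv W p → 0 ≤ padicValRat p W.j →
    Kato2004.ImageContainsSL2 W p → ∃ ℒ : ℚ_[p], PRRatio W p ℒ

/-! ## §2 Reading 1″ — the rank-one count through `ℒ` (printed shape; `e`, `t`, `a`, `c_p` cancel) -/

/-- **READING 1″ (rank ONE, PRINTED shape) — the Poitou–Tate count over a realised Kato descent datum,
through the Perrin-Riou ratio.** For `W/ℚ` globally minimal of analytic rank `1`, `p ≠ 2` additive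
and potentially good, (12.5.2), `Ш(E)` finite, a realised datum `D` and the ratio `ℒ` of its zeta
element: (i) `H²(ℤ[1/p],T)` is finite (memo R1-b: `#H² = p^t·#S_str(T)`); (ii) `ℒ ≠ 0 ⟺
[H¹(ℤ[1/p],T) : z] ≠ 0` (`H¹(ℤ[1/p],T) = p^a ℤ_p κ(x) ≅ ℤ_p` is torsion-free of rank one and
`loc_p`, `log_ω` are injective on it: R1-a); (iii) WHENEVER `[H¹(ℤ[1/p],T) : z] = p^m · #H²(ℤ[1/p],T)`
— `m ≥ 0` exists by the module-theoretic Thm. 14.5 (3)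
`Kato2004.exists_index_zeta_eq_pow_mul_natCard_coinvariants_of_index_ne_zero`, `m = 0` under KMC⁰ —
**`v_p(ℒ) = m + ord_p #Ш(E)[p^∞] + ord_p Tam(E)`**: write `z = λ·κ(x)`; (14.9.3) + Poitou–Tate for
Kummer ⊂ unramified-at-`ℓ ≠ p` (Rubin Thm. 1.7.3; exact annihilators at `ℓ ≠ p` by Coates LNM 1716
Lemma 3.6/3.8, `E₀(ℚ_ℓ^{ur})` `p`-divisible; `#H¹_ur(ℚ_ℓ,E[p^∞]) = c_ℓ^{(p)}`, Greenberg §3) give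
`#H²(ℤ[1/p],T) = p^{t + e + ord_p#Ш + Σ_{ℓ≠p} v_p c_ℓ − a}` and `[H¹(ℤ[1/p],T) : z] = p^{v(λ) − a}`,
so `v(λ) = m + t + e + ord_p #Ш + Σ_{ℓ≠p} v_p c_ℓ` (R1-e/f); the additive local index
`log_ω(E(ℚ_p) ⊗ ℤ_p) = p^{t − v_p(c_p)}ℤ_p` (Kim §3.2.3; `O6.integralLogAdditive_holds`) gives
`v(log_ω x) = e + t − v_p(c_p)`, and `ℒ = λ/log_ω(x)`. At `m = 0` this is VERBATIM
Burns–Kurihara–Sano Thm. 7.3 / 7.8 (d) for `r = 1` [p. 29–30: `⟨κ_∞⟩ = ℤ_p·v_ξ(∏L_ℓ)·#Ш[p^∞]·Tam·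
#tors⁻²·R_ω^{Boc}`, `R_ω^{Boc} = log_ω(x)·x`, `v_ξ ∈ ℤ_{(p)}^×` and `p ∤ #tors` for `E[p]`
irreducible] in Kato's normalisation (module docstring). Hypothesis schema; nothing asserted; EVERY
input printed (no conjecture inside — contrast `RankOnePRCountReading`).
[cite: Kato2004Asterisque, (14.9.3) (p. 240), Thm. 14.5 (3) (p. 236), §14.14 (p. 243)]
[cite: BurnsKuriharaSano2019, Thm. 7.3 (p. 29) and Thm. 7.8 (d) (p. 30), Remark 1.7 (i) (p. 5)]
[cite: Rubin2000, Thm. 1.7.3] [cite: CoatesLNM1716, Lemma 3.6 with proof (pp. 32–33) and Lemma 3.8 (p. 34)]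
[cite: GreenbergLNM1716, §3 after Lemma 3.3] [cite: Kim2022StructureSelmer, §3.2.3 display before Thm. 3.7 (PDF p. 16)] -/
def RankOneCountReading : Prop :=
  ∀ (W : WeierstrassCurve ℚ) [W.IsElliptic] [W.IsGloballyMinimal] (p : ℕ) [Fact p.Prime]
    (D : KatoDescentDatum p) (ℒ : ℚ_[p]),
    W.analyticRank = 1 → p ≠ 2 → Addv W p → 0 ≤ padicValRat p W.j →
    Kato2004.ImageContainsSL2 W p → Finite W.sha → IsOf W p D → PRRatio W p ℒ →
    Finite (coinvariants p D.H2) ∧ (ℒ ≠ 0 ↔ D.zetaIndex ≠ 0) ∧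
      ∀ m : ℕ, D.zetaIndex = p ^ m * D.h2Card →
        ℒ.valuation = (m : ℤ) +
          padicValNat p (Nat.card (AddCommGroup.primaryComponent W.sha p)) +
          padicValNat p W.tamagawaProduct

end Readings

/-! ## §3 The conjecture node PR^× (T-O6-A1′ as a NAMED input; `@[conjecture]`, nothing asserted) -/

/-- **PR^× — Perrin-Riou's 'Kato point' formula at the prime `p`, UP TO A `p`-ADIC UNIT, valuation
currency (T-O6-A1′ of the O6 lane; the rank-one companion of KMC⁰).** For `W/ℚ` globally minimal of
analytic rank one: Kato's zeta element HAS a Perrin-Riou ratio `ℒ ≠ 0` (Perrin-Riou's NON-VANISHING,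
Burns–Kurihara–Sano Conj. 2.8 (i)) and **`v_p(ℒ) = ord_p( L′(W,1) / (Ω_W · Reg(W)) )`** with
`L′(W,1)/(Ω_W·Reg W) ∈ ℚ` (`W.leadingLCoeff = L^{(r)}(W,1)/r!`, `r = 1`; `Ω_W = W.realPeriodRat`,
`Reg W = ĥ(x)` the tree's BSD period and regulator). PRINTED ANTECEDENT (the EXACT form):
Perrin-Riou, Ann. Inst. Fourier 43 (1993) §3.3 = Burns–Kurihara–Sano Conj. 2.8 (ii) [p. 10]
`_{c,d}z_ℚ = cd(c−1)(d−1)·(L′_S(E,1)/(Ω_ξ·R_∞))·log_ω(x)·x`, equivalently Thm. 1.4 [p. 4]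
`log_ω(z_ℚ) = (L′_S(E,1)/(Ω⁺·⟨x,x⟩_∞))·log_ω(x)²`, = their Conj. 1.5 at `r = 1` (Rem. 1.7 (i));
`Ω_ξ ≡ Ω⁺` up to `ℤ_{(p)}^×` for `E[p]` irreducible [p. 8]; the unit also absorbs `c_∞`, `#tors²`
and the Néron/`Ω_W` normalisation (the same period READING as in part 1's `DescentCountReading`).
STATUS: CONJECTURE IN PRINT at every `p`; THEOREM for `p ∤ 2N` (Burungale–Skinner–Tian–Wan
arXiv:2409.01350 Thm. 6.4 / Cor. 6.5; earlier Büyükboduk (good supersingular, square-free `N`),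
Büyükboduk–Pollack–Sasaki / Bertolini–Darmon–Venerucci (good ordinary), Venerucci (split
multiplicative, weak form)); NOTHING in print at an additive `p`. By Burns–Kurihara–Sano Thm. 7.3 any
two of {KMC⁰, BSD_p, PR^×} give the third on these rows (part 6). Over the interface `PRRatio`
(module docstring); `@[conjecture]`; nothing asserted.
[cite: PerrinRiou1993AIF, §3.3] [cite: BurnsKuriharaSano2019, Conj. 2.8 (p. 10), Thm. 1.4 (p. 4), Conj. 1.5 and Remark 1.7 (i) (p. 5), Thm. 7.3 and Thm. 7.6 (p. 29)]
[cite: BurungaleSkinnerTianWan2024, Thm. 6.4 and Cor. 6.5 (p. 59; p ∤ 2N only)] -/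
@[conjecture] def PerrinRiouUpToUnitAt
    (PRRatio : ∀ (W : WeierstrassCurve ℚ) [W.IsElliptic] [W.IsGloballyMinimal] (p : ℕ)
      [Fact p.Prime], ℚ_[p] → Prop)
    (W : WeierstrassCurve ℚ) [W.IsElliptic] [W.IsGloballyMinimal] (p : ℕ) [Fact p.Prime] : Prop :=
  W.analyticRank = 1 →
    ∃ ℒ : ℚ_[p], PRRatio W p ℒ ∧ ℒ ≠ 0 ∧
      ∃ q : ℚ, W.leadingLCoeff / ((W.realPeriodRat : ℂ) * (W.regulator : ℂ)) = (q : ℂ) ∧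
        ℒ.valuation = padicValRat p q

/-! ## §4 Bookkeeping `L^{(r)}/(r!·Ω·Reg) ↔ #Ш_an`, and the recovery of part 3's schema -/

section Bookkeeping

variable (W : WeierstrassCurve ℚ) [W.IsElliptic] [W.IsGloballyMinimal] (p : ℕ) [Fact p.Prime]

omit [W.IsGloballyMinimal] in
/-- **From `L^{(r)}(W,1)/(r!·Ω·Reg) = q` to `#Ш_an = q·#tors²/Tam` with
`ord_p #Ш_an = ord_p q − ord_p Tam`** (`p ∤ #E(ℚ)_tors` for `E[p]` irreducible; `q ≠ 0` because the
leading coefficient is non-zero). Bookkeeping. [cite: Miller2011LMS, Def. 1.1 (arXiv:1010.2431 p. 3)] [cite: Mazur1977, Ch. III §5, p. 157] -/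
theorem exists_shaAn_eq_of_leadingTerm_eq (hirr : Irr W p) (hL : W.leadingLCoeff ≠ 0) {q : ℚ}
    (hq : W.leadingLCoeff / ((W.realPeriodRat : ℂ) * (W.regulator : ℂ)) = (q : ℂ)) :
    ∃ q' : ℚ, shaAn W = (q' : ℂ) ∧
      padicValRat p q' = padicValRat p q - padicValNat p W.tamagawaProduct := by
  have hΩ : (W.realPeriodRat : ℂ) ≠ 0 := by exact_mod_cast W.realPeriodRat_pos_holds.ne'
  have hR : (W.regulator : ℂ) ≠ 0 := by exact_mod_cast W.regulator_pos'.ne'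
  have hc0 : 0 < W.tamagawaProduct := W.tamagawaProduct_pos_holds
  have ht0 : 0 < W.torsionOrder := W.torsionOrder_pos_holds
  have hq0 : q ≠ 0 := by
    rintro rfl
    rw [Rat.cast_zero, div_eq_zero_iff] at hq
    exact hq.elim hL (mul_ne_zero hΩ hR)
  refine ⟨q * (W.torsionOrder : ℚ) ^ 2 / (W.tamagawaProduct : ℚ), ?_, ?_⟩
  · have hLq : W.leadingLCoeff = (q : ℂ) * ((W.realPeriodRat : ℂ) * (W.regulator : ℂ)) := by
      rw [← hq, div_mul_cancel₀ _ (mul_ne_zero hΩ hR)]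
    rw [shaAn_def, hLq]
    push_cast
    field_simp
  · have ht : (W.torsionOrder : ℚ) ≠ 0 := by exact_mod_cast ht0.ne'
    have hcq : (W.tamagawaProduct : ℚ) ≠ 0 := by exact_mod_cast hc0.ne'
    have htors : padicValNat p W.torsionOrder = 0 :=
      padicValNat_torsionOrder_eq_zero_of_irreducible W p hirr
    rw [padicValRat.div (mul_ne_zero hq0 (pow_ne_zero 2 ht)) hcq,
      padicValRat.mul hq0 (pow_ne_zero 2 ht), pow_two, padicValRat.mul ht ht,
      padicValRat.of_nat, padicValRat.of_nat, htors]
    push_cast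
    ring

omit [W.IsGloballyMinimal] in
/-- **Conversely, from `#Ш_an = q'` to `L^{(r)}(W,1)/(r!·Ω·Reg) = q'·Tam/#tors²` with
`ord_p = ord_p q' + ord_p Tam`** (`p ∤ #tors`; `q' ≠ 0`). Bookkeeping.
[cite: Miller2011LMS, Def. 1.1 (arXiv:1010.2431 p. 3)] [cite: Mazur1977, Ch. III §5, p. 157] -/
theorem exists_leadingTerm_eq_of_shaAn_eq (hirr : Irr W p) (hL : W.leadingLCoeff ≠ 0) {q' : ℚ}
    (hq' : shaAn W = (q' : ℂ)) :
    ∃ q : ℚ, W.leadingLCoeff / ((W.realPeriodRat : ℂ) * (W.regulator : ℂ)) = (q : ℂ) ∧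
      padicValRat p q = padicValRat p q' + padicValNat p W.tamagawaProduct := by
  have hΩ : (W.realPeriodRat : ℂ) ≠ 0 := by exact_mod_cast W.realPeriodRat_pos_holds.ne'
  have hR : (W.regulator : ℂ) ≠ 0 := by exact_mod_cast W.regulator_pos'.ne'
  have hc0 : 0 < W.tamagawaProduct := W.tamagawaProduct_pos_holds
  have ht0 : 0 < W.torsionOrder := W.torsionOrder_pos_holds
  have hcC : (W.tamagawaProduct : ℂ) ≠ 0 := by exact_mod_cast hc0.ne'
  have htC : (W.torsionOrder : ℂ) ≠ 0 := by exact_mod_cast ht0.ne'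
  have hq0 : q' ≠ 0 := by
    rintro rfl
    rw [Rat.cast_zero, shaAn_def, div_eq_zero_iff] at hq'
    rcases hq' with h | h
    · exact (mul_ne_zero hL (pow_ne_zero 2 htC)) h
    · exact (mul_ne_zero (mul_ne_zero hΩ hcC) hR) h
  refine ⟨q' * (W.tamagawaProduct : ℚ) / (W.torsionOrder : ℚ) ^ 2, ?_, ?_⟩
  · rw [shaAn_def, div_eq_iff (mul_ne_zero (mul_ne_zero hΩ hcC) hR)] at hq'
    rw [div_eq_iff (mul_ne_zero hΩ hR)]
    have key : W.leadingLCoeff * (W.torsionOrder : ℂ) ^ 2 =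
        ((q' * (W.tamagawaProduct : ℚ) / (W.torsionOrder : ℚ) ^ 2 : ℚ) : ℂ) *
          ((W.realPeriodRat : ℂ) * (W.regulator : ℂ)) * (W.torsionOrder : ℂ) ^ 2 := by
      rw [hq']
      push_cast
      field_simp
    exact mul_right_cancel₀ (pow_ne_zero 2 htC) key
  · have ht : (W.torsionOrder : ℚ) ≠ 0 := by exact_mod_cast ht0.ne'
    have hcq : (W.tamagawaProduct : ℚ) ≠ 0 := by exact_mod_cast hc0.ne'
    have htors : padicValNat p W.torsionOrder = 0 :=
      padicValNat_torsionOrder_eq_zero_of_irreducible W p hirr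
    rw [padicValRat.div (mul_ne_zero hq0 hcq) (pow_ne_zero 2 ht), padicValRat.mul hq0 hcq,
      pow_two, padicValRat.mul ht ht, padicValRat.of_nat, padicValRat.of_nat, htors]
    push_cast
    ring

end Bookkeeping

section Recovery

variable {IsOf : ∀ (W : WeierstrassCurve ℚ) [W.IsElliptic] [W.IsGloballyMinimal] (p : ℕ) [Fact p.Prime],
  KatoDescentDatum p → Prop}
variable {PRRatio : ∀ (W : WeierstrassCurve ℚ) [W.IsElliptic] [W.IsGloballyMinimal] (p : ℕ)
  [Fact p.Prime], ℚ_[p] → Prop}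

/-- **RECOVERY of part 3's schema: Reading 1″ (printed) ∧ PR^× on the rows ⇒ `RankOnePRCountReading`.**
So the split is a genuine refinement of `RankOnePRCountReading` = (count) ∧ (PR^×), and every
theorem of part 4 (`rankOne_bsdp_of_kmc_of_readings`, `rankOne_kmc_iff_missingLowerBoundAt_of_readings`,
…) applies under the split readings. (`hmod`: modularity, for `L′(W,1) ≠ 0` via
`leadingLCoeff_ne_zero`.) [cite: BurnsKuriharaSano2019, Thm. 7.3 and Thm. 7.6 (p. 29)] [cite: Kato2004Asterisque, §14.14 (p. 243)] -/
theorem rankOnePRCountReading_of_count_of_perrinRiou (hC : RankOneCountReading IsOf PRRatio)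
    (hmod : hasEntireLFunction_rat)
    (hPR : ∀ (W : WeierstrassCurve ℚ) [W.IsElliptic] [W.IsGloballyMinimal] (p : ℕ) [Fact p.Prime],
      W.analyticRank = 1 → p ≠ 2 → Addv W p → 0 ≤ padicValRat p W.j →
      Kato2004.ImageContainsSL2 W p → PerrinRiouUpToUnitAt PRRatio W p) :
    RankOnePRCountReading IsOf := by
  intro W _ _ p _ D hr hp hadd hj hK hfin hDof
  obtain ⟨ℒ, hℒ, -, q, hq, hv⟩ := hPR W p hr hp hadd hj hK hr
  obtain ⟨hfinH2, -, hcount⟩ := hC W p D ℒ hr hp hadd hj hK hfin hDof hℒ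
  refine ⟨hfinH2, fun m hm ↦ ?_⟩
  have hval := hcount m hm
  obtain ⟨q', hq', hv'⟩ := exists_shaAn_eq_of_leadingTerm_eq W p (irr_of_imageContainsSL2 W p hK)
    (W.leadingLCoeff_ne_zero_holds (hmod W)) hq
  refine ⟨q', hq', ?_⟩
  rw [hv', ← hv, hval]
  ring

end Recovery

end Summit.BirchSwinnertonDyer.Rank1Residual.Additive

end
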